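import Summits.Ventures.QEC.Thresholds.ToricCodePhenomenologicalUnconditional
import Summits.Ventures.QEC.Thresholds.ToricCodeXSectorPhenomenological
import Literature.InformationTheory.QuantumCodes.ToricCodeLatticeConverses
import HarnessLib

/-!
# The lattice toric code under phenomenological noise: the certified INTERVAL `.0106 < p_c^{ph} ≤ 1/4`
# (ceiling for EVERY space-time decoder family and every schedule of rounds `T_L ≥ 1`)

Venture QEC, `Summits/Ventures/QEC/Thresholds/` (LADDER-QEC rung Q5; qec-lit-2 gen 4). HONEST FRAMING. The DKLP
phenomenological row of the census (`phenomFailureFamily T D` of `ToricCodePhenomenologicalThresholds.lean`: `q = p`,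
perfect closing round, space-time decoders, schedule `T`) carried the certified FLOOR `p_c > .0106`
(`phenom_accuracyThreshold_gt_0106`, minimum-weight space-time decoding, polynomially bounded `T`).
`Literature/…/ToricCodeLatticeConverses.lean` identifies the DKLP space-time model with the generic CSS one
(`ToricCode.phenomFailureProb_eq_css`, definitional) and proves, through the genie comparison of
`CSSPhenomenologicalConverse.lean` and the lattice duality, `1/4 ≤ phenomFailureProb L T D (1/4) (1/4)` for EVERY
space-time decoder and every `T ≥ 1`. Packaging:

* `toric_phenom_threshold_le_quarter`: every certified threshold lower bound of `phenomFailureFamily T D` is `≤ 1/4`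
  (ANY space-time decoder family, `T_L ≥ 1`);
* `toric_phenom_accuracyThreshold_mem`: **`.0106 < p_c^{ph} ≤ 1/4`** (floor: minimum-weight space-time decoders,
  polynomially bounded `T_L ≥ 1`); numerics `≈ .029`–`.033` (Wang–Harrington–Preskill, Ohno et al.) — VALIDATED
  column, not theorems;
* `X`-sector (bit flips, noisy PLAQUETTE record; the census family `xPhenomFailureFamily (fun L => toricCode (L+1)) T DX`
  of `ToricCodeXSectorPhenomenological.lean`): ceiling `≤ 1/4` for every space-time decoder family
  (`toric_x_phenom_threshold_le_quarter`) and the interval **`.0101 < p_c^{ph,X} ≤ 1/4`**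
  (`toric_x_phenom_accuracyThreshold_mem`).

Kernel axioms only; no named fact; no `native_decide`; no new definition.

## References

* [DennisEtAl2002] E. Dennis, A. Kitaev, A. Landahl, J. Preskill, J. Math. Phys. 43 (2002) 4452, §4.6, §5.3
  eq. (threshold_iso_num).
* [RichardsonUrbanke2008] T. Richardson, R. Urbanke, *Modern Coding Theory*, Lemma 4.78 (Erasure Decomposition).
-/

noncomputable section

namespace Summit.Ventures.QEC.Thresholds

open Filter Topology
open Literature.InformationTheory.QuantumCodes
open Literature.InformationTheory.QuantumCodes.ToricCode

/-- **Toric phenomenological threshold `≤ 1/4` for EVERY space-time decoder family** (`q = p`, schedule `T_L ≥ 1`).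
[cite: DennisEtAl2002, §4.6 (p_c) and §5.3 (p = q); RichardsonUrbanke2008, Lemma 4.78] -/
theorem toric_phenom_threshold_le_quarter {T : ℕ → ℕ} (hT : ∀ L, 0 < T L) (D : (L : ℕ) → STDecoder (L + 1) (T L))
    {a : ℝ} (ha : IsThresholdLowerBound (phenomFailureFamily T D) a) : a ≤ 1 / 4 :=
  ToricCode.phenom_threshold_le_quarter T hT D ha

/-- **`.0106 < p_c^{ph} ≤ 1/4` for the toric code under phenomenological noise** — a certified two-sided interval
(floor: memory-4 cubic walk count, minimum-weight space-time decoders, polynomially bounded rounds `T_L ≥ 1`;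
ceiling: every space-time decoder family). [cite: DennisEtAl2002, §5.3 eq. (threshold_iso_num) and §4.6; RichardsonUrbanke2008, Lemma 4.78] -/
theorem toric_phenom_accuracyThreshold_mem {T : ℕ → ℕ} (hT : IsPolyBounded T) (hT1 : ∀ L, 0 < T L)
    {D : (L : ℕ) → STDecoder (L + 1) (T L)}
    (hD : ∀ L, (D L).IsMinWeight (stSyn (L + 1) (T L)) (stCycles (L + 1) (T L)) hammingNorm) :
    (0.0106 : ℝ) < accuracyThreshold (phenomFailureFamily T D) ∧ accuracyThreshold (phenomFailureFamily T D) ≤ 1 / 4 :=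
  ⟨phenom_accuracyThreshold_gt_0106 hT hD,
    ToricCode.phenom_threshold_le_quarter T hT1 D (isThresholdLowerBound_accuracyThreshold _)⟩

/-- The canonical instance: `T(L) = L + 1` rounds, the canonical minimum-weight space-time decoders —
`.0106 < p_c^{ph} ≤ 1/4`. [cite: DennisEtAl2002, §5.3 eq. (threshold_iso_num) and §4.6] -/
theorem toric_phenom_accuracyThreshold_stMinWeight_mem :
    (0.0106 : ℝ) < accuracyThreshold (phenomFailureFamily (fun L => L + 1)
        fun L => Decoder.minWeight (stSyn (L + 1) (L + 1)) hammingNorm) ∧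
      accuracyThreshold (phenomFailureFamily (fun L => L + 1)
        fun L => Decoder.minWeight (stSyn (L + 1) (L + 1)) hammingNorm) ≤ 1 / 4 :=
  ⟨ToricCode.phenom_accuracyThreshold_stMinWeight_gt_0106,
    ToricCode.phenom_threshold_le_quarter (fun L => L + 1) (fun L => Nat.succ_pos L) _
      (isThresholdLowerBound_accuracyThreshold _)⟩

/-! ### The `X`-sector (noisy plaquette record) -/

/-- **Toric `X`-sector phenomenological threshold `≤ 1/4` for EVERY space-time decoder family** (bit flips with
noisy plaquette-syndrome measurement, `q = p`, schedule `T_L ≥ 1`). [cite: DennisEtAl2002, §4.6 (p_c) and §5.3 (p = q); RichardsonUrbanke2008, Lemma 4.78] -/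
theorem toric_x_phenom_threshold_le_quarter {T : ℕ → ℕ} (hT : ∀ L, 0 < T L)
    (DX : ∀ L, CSSPhenom.STDecoder (Vertex (L + 1)) (Edge (L + 1)) (T L)) {a : ℝ}
    (ha : IsThresholdLowerBound (xPhenomFailureFamily (fun L => toricCode (L + 1)) T DX) a) : a ≤ 1 / 4 :=
  phenom_threshold_le_quarter_of_symm (fun L => (toricCode (L + 1)).swap)
    (fun L => by rw [CSSCode.k_swap]; exact toricCode_k_pos)
    (fun L y => (ToricCode.uncorrectableProb_dual (L := L + 1) y).symm) T hT DX ha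

/-- **`.0101 < p_c^{ph,X} ≤ 1/4` for the toric code, `X`-sector, phenomenological noise** — certified two-sided
interval (floor: minimum-weight space-time decoders of the plaquette record, polynomially bounded `T_L ≥ 1`; ceiling:
every space-time decoder family). [cite: DennisEtAl2002, §5.3 eq. (threshold_iso_num) and §4.6; DumerKovalevPryadko2015, Thm 3] -/
theorem toric_x_phenom_accuracyThreshold_mem {T : ℕ → ℕ} (hT : IsPolyBounded T) (hT1 : ∀ L, 0 < T L)
    (DX : ∀ L, CSSPhenom.STDecoder (Vertex (L + 1)) (Edge (L + 1)) (T L))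
    (hDX : ∀ L, (DX L).IsMinWeight (CSSPhenom.stSyn (toricCode (L + 1)).HZ (T L))
      (CSSPhenom.stCycles (toricCode (L + 1)).HZ (T L)) hammingNorm) :
    (0.0101 : ℝ) < accuracyThreshold (xPhenomFailureFamily (fun L => toricCode (L + 1)) T DX) ∧
      accuracyThreshold (xPhenomFailureFamily (fun L => toricCode (L + 1)) T DX) ≤ 1 / 4 :=
  ⟨toric_x_phenom_accuracyThreshold_gt_0101 hT DX hDX,
    toric_x_phenom_threshold_le_quarter hT1 DX (isThresholdLowerBound_accuracyThreshold _)⟩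


end Summit.Ventures.QEC.Thresholds
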